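import Literature.AlgebraicGeometry.Frobenioids.BirationalizationBiratData
import Literature.AlgebraicGeometry.Frobenioids.BiratLocalization
import Literature.AlgebraicGeometry.Frobenioids.BiratGerms
import Literature.AlgebraicGeometry.Frobenioids.ModelFrobenioidComparison
import Literature.AlgebraicGeometry.Frobenioids.UnitEquivalenceProofs
import Literature.AlgebraicGeometry.Frobenioids.DivisorialDescriptionsSectionsProofs
import Literature.AlgebraicGeometry.Frobenioids.DivisorialDescriptionsIII
import HarnessLib

/-!
# Frobenioids I, Theorem 5.1 (iv), "Moreover, `C` is of model type": a Frobenioid of isotropic and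
# unit-trivial type is of birationally Frobenius-normalized type (abc-iut cell, layer L1, node
# `FrdI:Thm5.1(iv)`, sub-DAG row `FrdI:Thm5.1(iv)/T51iv-L05` «UnitTrivialIsBiratFrobNormalized»)

Mochizuki, *The geometry of Frobenioids I: the general theory*, Kyushu J. Math. **62** (2008)
293–400, §5, Theorem 5.1 (iv), kurims text p. 97 ll. 18–20 (statement), proof p. 100 ll. 1–4
[cite: MochizukiFrdI2008, Thm. 5.1 (iv) p.97]:

> "(iv) Suppose that `C` is of unit-trivial type. Then … Moreover, `C` is of model type."
> Proof (p. 100): "Moreover, since `C` is of unit-trivial type, it follows immediately from the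
> structure of an elementary Frobenioid [cf. the description of the kernel in Proposition 4.4, (iii)]
> that `C` is of birationally Frobenius-normalized type, hence also of model type, as desired."

PROOF-ONLY companion (no definitions). Standing hypotheses of Theorem 5.1: `F : C → F_Φ` a Frobenioid
(`IsFrobenioid F`) of isotropic type; (iv) adds unit-trivial type (`IsOfUnitTrivialType F`, i.e. every
`O^×(A)` is trivial). THE birationalization is seat abc-iut-L6-t8's `Birat F hF hsq` /
`toBirat F hF hsq` with structure functor `Birat.toElemGp hF hsq : C^birat → F_{Φ^gp}`
(`BirationalizationFunctor.lean`), packaged as `biratData hF hsq` (seat abc-iut-L6-t6,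
`BirationalizationBiratData.lean`); `hsq` = Prop. 1.11 (vii), discharged for every Frobenioid by
`hasBiratSquares_of_isFrobenioid` (`BiratLocalization.lean`) and kept as a parameter where the typed
predicates carry it.

What is proved (the printed "immediately", made explicit):
* `isFrobeniusNormalized_of_faithful` — "the structure of an elementary Frobenioid": if the structure
  functor `G : C' → F_Ψ` of a pre-Frobenioid is FAITHFUL, every object is Frobenius-normalized
  (Def. 1.2 (iv): `φ ≫ α^{deg_Fr φ} = α ≫ φ` for base-identity `φ`, `α ∈ O^▷`), because both sides
  have the same image `(id, deg_Fr(φ)·Div(α) + Div(φ), deg_Fr(φ))` in `F_Ψ` (`End_pow_eq` computes the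
  powers of a base-identity linear endomorphism of `F_Ψ`);
* `eq_of_invariants_eq_of_isOfUnitTrivialType` / `faithful_of_isOfUnitTrivialType` — in a Frobenioid
  of isotropic and unit-trivial type two co-objective arrows with the same `(Base, Div, deg_Fr)` are
  EQUAL, i.e. `C → F_Φ` is faithful ([FrdI] Prop. 3.3 (ii), seat abc-iut-L1-t13's
  `FrdI.exists_unit_of_invariants_eq`, the unit being trivial);
* `Birat.toElemGp_faithful` — hence `C^birat → F_{Φ^gp}` is FAITHFUL ("the description of the kernel
  in Proposition 4.4, (iii)": two fractions over a common co-angular pre-step with the same image have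
  numerators with the same invariants — `Φ → Φ^gp` is injective, `Φ` being divisorial);
* `isBiratFrobeniusNormalized_of_isOfUnitTrivialType` — every object is birationally
  Frobenius-normalized (Def. 4.5 (i) in the REAL vocabulary `IsBiratFrobeniusNormalized F hF hsq` of
  `ModelFrobenioidComparison.lean`, the hypothesis shape of Thm. 5.2 (iv)), and the same over seat
  abc-iut-L1-t3's interface at THE birationalization,
  `isOfBiratFrobeniusNormalizedType_biratData_of_isOfUnitTrivialType :
    PreFrobenioidData.IsOfBiratFrobeniusNormalizedType (biratData hF hsq)`;
* `isOfModelType_of_isOfUnitTrivialType` — "Moreover, `C` is of model type", UNCONDITIONALLY, in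
  the form `IsOfModelType F hF hsq` that Thm. 5.2 (iv) consumes: the pre-model half is seat
  abc-iut-L1-d3's `thm51iv_preModel_of_thm51iii` (`DivisorialDescriptionsSectionsProofs.lean`) fed
  with the two "In particular" clauses of Thm. 5.1 (iii) (`thm51iii_iso_of_baseIso`,
  `thm51iii_frobeniusTrivial_isAutAmple`, `DivisorialDescriptionsIII.lean`, seats abc-iut-found /
  abc-iut-L1-t10), consumed by name; and `thm51iv_modelType_biratData : Thm51iv_modelType F
  (biratData hF hsq)` — the fourth named statement of `DivisorialDescriptionsSections.lean` (seat
  abc-iut-L1-t5; a schema in the birationalization datum `B`) AT THE birationalization.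
No statement of the paper is strengthened; no side is taken on [IUTchIII] Cor. 3.12.
-/

namespace Literature.AlgebraicGeometry.Frobenioids

open CategoryTheory Opposite

universe w v v' u u'

/-! ### Powers of a base-identity linear endomorphism of an elementary Frobenioid -/

namespace ElemFrobenioid

variable {D : Type u} [Category.{v} D] {Ψ : Dᵒᵖ ⥤ CommMonCat.{w}}

/-- In `F_Ψ`, the `n`-th power (in `End`) of an endomorphism `e = (id, Div e, 1)` is
`(id, n · Div e, 1)` — "the structure of an elementary Frobenioid" (FrdI Def. 1.1 (iii)).
[cite: MochizukiFrdI2008, Def. 1.1 (iii) p.20] -/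
theorem End_pow_eq {O : ElemFrobenioid Ψ} (e : End O) (hb : Base e = 𝟙 O.base) (hd : degFr e = 1)
    (n : ℕ) : e ^ n = homMk (𝟙 O.base) (Div e ^ n) 1 := by
  induction n with
  | zero =>
    rw [pow_zero, pow_zero, End.one_def]
    rfl
  | succ n ih =>
    rw [show e ^ (n + 1) = e ^ n * e from pow_succ _ _, End.mul_def, ih]
    apply Hom.ext
    · change Base e ≫ 𝟙 O.base = 𝟙 O.base
      rw [hb, Category.comp_id]
    · change pull Ψ (Base e) (Div e ^ n) * Div e ^ ((1 : ℕ+) : ℕ) = Div e ^ (n + 1)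
      rw [hb, pull_id, PNat.one_coe, pow_one, pow_succ]
    · change degFr e * 1 = 1
      rw [hd, mul_one]

/-- In `F_Ψ`, for endomorphisms `p = (id, Div p, d)` and `e = (id, Div e, 1)` of an object:
`p ≫ e^d = e ≫ p` — both sides are `(id, d · Div e + Div p, d)` (FrdI Def. 1.1 (iii); the identity
behind Def. 1.2 (iv) "Frobenius-normalized"). [cite: MochizukiFrdI2008, Def. 1.1 (iii) p.20] -/
theorem comp_End_pow_eq_comp {O : ElemFrobenioid Ψ} (p : O ⟶ O) (e : End O) (hp : Base p = 𝟙 O.base)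
    (he : Base e = 𝟙 O.base) (hd : degFr e = 1) :
    p ≫ (show O ⟶ O from e ^ (degFr p : ℕ)) = (show O ⟶ O from e) ≫ p := by
  rw [End_pow_eq e he hd]
  apply Hom.ext
  · change Base p ≫ 𝟙 O.base = Base e ≫ Base p
    rw [hp, he, Category.comp_id]
  · change pull Ψ (Base p) (Div e ^ (degFr p : ℕ)) * Div p ^ ((1 : ℕ+) : ℕ) =
      pull Ψ (Base e) (Div p) * Div e ^ (degFr p : ℕ)
    rw [hp, he, pull_id, pull_id, PNat.one_coe, pow_one, mul_comm]
  · change degFr p * 1 = degFr e * degFr p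
    rw [hd, mul_one, one_mul]

end ElemFrobenioid

namespace PreFrobenioid

/-! ### A pre-Frobenioid with FAITHFUL structure functor is of Frobenius-normalized type -/

section Faithful

variable {D : Type u} [Category.{v} D] {Ψ : Dᵒᵖ ⥤ CommMonCat.{w}}
  {C' : Type u'} [Category.{v'} C'] (G : C' ⥤ ElemFrobenioid Ψ)

/-- If the structure functor `G : C' → F_Ψ` is faithful, then every object of `C'` is
Frobenius-normalized (FrdI Def. 1.2 (iv)): for a base-identity endomorphism `φ` of Frobenius degree
`d` and `α ∈ O^▷`, both `φ ≫ α^d` and `α ≫ φ` map to `(id, d · Div(α) + Div(φ), d)` in `F_Ψ`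
("the structure of an elementary Frobenioid", proof of Thm. 5.1 (iv), FrdI p. 100).
[cite: MochizukiFrdI2008, Thm. 5.1 (iv) p.100] -/
theorem isFrobeniusNormalized_of_faithful [G.Faithful] (X : C') : IsFrobeniusNormalized G X := by
  intro φ hφ α hα
  obtain ⟨hαb, hαl⟩ := hα
  apply G.map_injective
  have hpow : G.map (show X ⟶ X from α ^ (degFr G φ : ℕ)) =
      (show G.obj X ⟶ G.obj X from (G.mapEnd X α) ^ (degFr G φ : ℕ)) := by
    change G.mapEnd X (α ^ (degFr G φ : ℕ)) = (G.mapEnd X α) ^ (degFr G φ : ℕ)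
    rw [map_pow]
  rw [G.map_comp, G.map_comp, hpow]
  exact ElemFrobenioid.comp_End_pow_eq_comp (G.map φ) (G.mapEnd X α) hφ hαb hαl

end Faithful

variable {D : Type u} [Category.{v} D] {Φ : Dᵒᵖ ⥤ CommMonCat.{w}}
  {C : Type u'} [Category.{v'} C] {F : C ⥤ ElemFrobenioid Φ}

/-! ### Unit-trivial type: `C → F_Φ` is faithful -/

variable (F) in
/-- **Thm. 5.1 (iv), proof** (via [FrdI] Prop. 3.3 (ii), p. 59): in a Frobenioid of unit-trivial type,
two arrows out of an ISOTROPIC object with the same Frobenius degree, zero divisor and base map are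
equal (they differ by a unit of an intermediate isotropic object, which is trivial).
[cite: MochizukiFrdI2008, Thm. 5.1 (iv) p.100] -/
theorem eq_of_invariants_eq_of_isUnitTrivial (hF : IsFrobenioid F) (hut : IsOfUnitTrivialType F)
    {A B : C} (hA : IsIsotropic F A) {φ ψ : A ⟶ B} (hdeg : degFr F φ = degFr F ψ)
    (hdiv : Div F φ = Div F ψ) (hbase : Base F φ = Base F ψ) : φ = ψ := by
  obtain ⟨Y, γ, δ, u, hu, h₁, h₂⟩ := FrdI.exists_unit_of_invariants_eq hF hA φ ψ hdeg hdiv hbase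
  have hu1 : u = 1 := hut Y u hu
  rw [h₁, h₂, hu1]
  change γ ≫ δ = γ ≫ 𝟙 Y ≫ δ
  rw [Category.id_comp]

variable (F) in
/-- **Thm. 5.1 (iv), proof**: in a Frobenioid of isotropic and unit-trivial type two co-objective
arrows with the same `(Base, Div, deg_Fr)` coincide. [cite: MochizukiFrdI2008, Thm. 5.1 (iv) p.100] -/
theorem eq_of_invariants_eq_of_isOfUnitTrivialType (hF : IsFrobenioid F) (hiso : IsOfIsotropicType F)
    (hut : IsOfUnitTrivialType F) {A B : C} {φ ψ : A ⟶ B} (hdeg : degFr F φ = degFr F ψ)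
    (hdiv : Div F φ = Div F ψ) (hbase : Base F φ = Base F ψ) : φ = ψ :=
  eq_of_invariants_eq_of_isUnitTrivial F hF hut (hiso A) hdeg hdiv hbase

variable (F) in
/-- **Thm. 5.1 (iv), proof**: the structure functor `C → F_Φ` of a Frobenioid of isotropic and
unit-trivial type is faithful. [cite: MochizukiFrdI2008, Thm. 5.1 (iv) p.100] -/
theorem faithful_of_isOfUnitTrivialType (hF : IsFrobenioid F) (hiso : IsOfIsotropicType F)
    (hut : IsOfUnitTrivialType F) : F.Faithful :=
  ⟨fun {_ _} _ _ h =>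
    eq_of_invariants_eq_of_isOfUnitTrivialType F hF hiso hut
      (congrArg ElemFrobenioid.Hom.degFr h) (congrArg ElemFrobenioid.Hom.div h)
      (congrArg ElemFrobenioid.Hom.base h)⟩

/-! ### Unit-trivial type: `C^birat → F_{Φ^gp}` is faithful -/

/-- **Thm. 5.1 (iv), proof** ("the description of the kernel in Proposition 4.4, (iii)"): for a
Frobenioid of isotropic and unit-trivial type, the structure functor `C^birat → F_{Φ^gp}` of THE
birationalization is FAITHFUL — two fractions over a common co-angular pre-step with the same base map,
`Φ^gp`-divisor and Frobenius degree have numerators with the same `(Base, Div, deg_Fr)` (`Φ(A) → Φ(A)^gp`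
is injective, `Φ` being divisorial), hence equal numerators. [cite: MochizukiFrdI2008, Thm. 5.1 (iv) p.100] -/
theorem Birat.toElemGp_faithful (hF : IsFrobenioid F) (hsq : HasBiratSquares F)
    (hiso : IsOfIsotropicType F) (hut : IsOfUnitTrivialType F) : (Birat.toElemGp hF hsq).Faithful := by
  refine ⟨fun {X Y} g₁ g₂ h => ?_⟩
  obtain ⟨f₁, rfl⟩ := Birat.homMk_surjective g₁
  obtain ⟨f₂, rfl⟩ := Birat.homMk_surjective g₂
  rw [Birat.toElemGp_map_homMk, Birat.toElemGp_map_homMk] at h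
  have hb : BiratFrac.base f₁ = BiratFrac.base f₂ := congrArg ElemFrobenioid.Hom.base h
  have hdv : BiratFrac.divGp f₁ = BiratFrac.divGp f₂ := congrArg ElemFrobenioid.Hom.div h
  have hdg : BiratFrac.deg f₁ = BiratFrac.deg f₂ := congrArg ElemFrobenioid.Hom.degFr h
  -- a common co-angular pre-step refinement of the two denominators
  obtain ⟨T, κ, κ', hκ, hκ', hden⟩ :=
    exists_common_refinement hF f₁.den f₂.den f₁.den_mem f₂.den_mem
  -- the two restricted fractions, written over the SAME denominator `κ ≫ f₁.den`
  have e₂ := BiratFrac.eq_of_eq (A := X.out) (B := Y.out) hden (rfl : κ' ≫ f₂.num = κ' ≫ f₂.num)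
    (hκ.comp hF f₁.den_mem) (hκ'.comp hF f₂.den_mem)
  have hb' : BiratFrac.base (⟨T, κ ≫ f₁.den, κ ≫ f₁.num, hκ.comp hF f₁.den_mem⟩ : BiratFrac F X.out Y.out) =
      BiratFrac.base (⟨T, κ ≫ f₁.den, κ' ≫ f₂.num, hκ.comp hF f₁.den_mem⟩ : BiratFrac F X.out Y.out) := by
    rw [BiratFrac.base_restrict hF f₁ κ hκ, e₂.1, BiratFrac.base_restrict hF f₂ κ' hκ', hb]
  have hdg' : BiratFrac.deg (⟨T, κ ≫ f₁.den, κ ≫ f₁.num, hκ.comp hF f₁.den_mem⟩ : BiratFrac F X.out Y.out) =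
      BiratFrac.deg (⟨T, κ ≫ f₁.den, κ' ≫ f₂.num, hκ.comp hF f₁.den_mem⟩ : BiratFrac F X.out Y.out) := by
    rw [BiratFrac.deg_restrict hF f₁ κ hκ, e₂.2.1, BiratFrac.deg_restrict hF f₂ κ' hκ', hdg]
  have hdv' : BiratFrac.divGp (⟨T, κ ≫ f₁.den, κ ≫ f₁.num, hκ.comp hF f₁.den_mem⟩ : BiratFrac F X.out Y.out) =
      BiratFrac.divGp (⟨T, κ ≫ f₁.den, κ' ≫ f₂.num, hκ.comp hF f₁.den_mem⟩ : BiratFrac F X.out Y.out) := by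
    rw [BiratFrac.divGp_restrict hF f₁ κ hκ, e₂.2.2, BiratFrac.divGp_restrict hF f₂ κ' hκ', hdv]
  -- read off the invariants of the numerators
  haveI : IsIso (Base F (κ ≫ f₁.den)) := (hκ.comp hF f₁.den_mem).2.2
  have hbase : Base F (κ ≫ f₁.num) = Base F (κ' ≫ f₂.num) := by
    have e : inv (Base F (κ ≫ f₁.den)) ≫ Base F (κ ≫ f₁.num) =
        inv (Base F (κ ≫ f₁.den)) ≫ Base F (κ' ≫ f₂.num) := hb'
    exact (cancel_epi _).mp e
  have hdeg : degFr F (κ ≫ f₁.num) = degFr F (κ' ≫ f₂.num) := hdg'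
  have hdiv : Div F (κ ≫ f₁.num) = Div F (κ' ≫ f₂.num) := by
    have e : pullGp Φ (inv (Base F (κ ≫ f₁.den)))
          (Algebra.GrothendieckGroup.of (Div F (κ ≫ f₁.num)) /
            Algebra.GrothendieckGroup.of (Div F (κ ≫ f₁.den)) ^ (degFr F (κ ≫ f₁.num) : ℕ)) =
        pullGp Φ (inv (Base F (κ ≫ f₁.den)))
          (Algebra.GrothendieckGroup.of (Div F (κ' ≫ f₂.num)) /
            Algebra.GrothendieckGroup.of (Div F (κ ≫ f₁.den)) ^ (degFr F (κ' ≫ f₂.num) : ℕ)) := hdv'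
    rw [hdeg] at e
    have e' := div_left_injective (pullGp_injective (Φ := Φ) (inv (Base F (κ ≫ f₁.den))) e)
    exact (hF.isPreFrobenioid.isDivisorial (baseObj F T)).isPreDivisorial.isIntegral.injective_of e'
  have hnum : κ ≫ f₁.num = κ' ≫ f₂.num :=
    eq_of_invariants_eq_of_isOfUnitTrivialType F hF hiso hut hdeg hdiv hbase
  exact Birat.homMk_sound ⟨T, κ, κ', hκ, hκ', hden, hnum⟩

/-! ### Theorem 5.1 (iv): birationally Frobenius-normalized, hence model type -/

variable (F) in
/-- **Thm. 5.1 (iv), "`C` is of birationally Frobenius-normalized type"** (FrdI p. 100, Def. 4.5 (i)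
p. 86) in the vocabulary of `ModelFrobenioidComparison.lean`: for a Frobenioid of isotropic and
unit-trivial type every object is birationally Frobenius-normalized — its image in THE
birationalization `C^birat` is Frobenius-normalized for `C^birat → F_{Φ^gp}` (faithful, so the identity
holds because it holds in `F_{Φ^gp}`). [cite: MochizukiFrdI2008, Thm. 5.1 (iv) p.97] -/
theorem isBiratFrobeniusNormalized_of_isOfUnitTrivialType (hF : IsFrobenioid F)
    (hsq : HasBiratSquares F) (hiso : IsOfIsotropicType F) (hut : IsOfUnitTrivialType F) (A : C) :
    IsBiratFrobeniusNormalized F hF hsq A :=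
  haveI := Birat.toElemGp_faithful hF hsq hiso hut
  isFrobeniusNormalized_of_faithful (Birat.toElemGp hF hsq) ((toBirat F hF hsq).obj A)

/-- Every object of `C^birat` (not only the images `A^birat`, which exhaust them) is
Frobenius-normalized for `C^birat → F_{Φ^gp}`. [cite: MochizukiFrdI2008, Thm. 5.1 (iv) p.100] -/
theorem Birat.isFrobeniusNormalized_of_isOfUnitTrivialType (hF : IsFrobenioid F)
    (hsq : HasBiratSquares F) (hiso : IsOfIsotropicType F) (hut : IsOfUnitTrivialType F)
    (X : Birat F hF hsq) : IsFrobeniusNormalized (Birat.toElemGp hF hsq) X :=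
  haveI := Birat.toElemGp_faithful hF hsq hiso hut
  isFrobeniusNormalized_of_faithful (Birat.toElemGp hF hsq) X

/-- **Thm. 5.1 (iv), "of birationally Frobenius-normalized type"** over seat abc-iut-L1-t3's
interface (Def. 4.5 (i), `PreFrobenioidData.IsOfBiratFrobeniusNormalizedType`) AT THE birationalization
`biratData hF hsq` (operations `C^birat → F_{0_D}`; base maps and Frobenius degrees are those of
`C^birat → F_{Φ^gp}`). [cite: MochizukiFrdI2008, Thm. 5.1 (iv) p.97] -/
theorem isOfBiratFrobeniusNormalizedType_biratData_of_isOfUnitTrivialType (hF : IsFrobenioid F)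
    (hsq : HasBiratSquares F) (hiso : IsOfIsotropicType F) (hut : IsOfUnitTrivialType F) :
    PreFrobenioidData.IsOfBiratFrobeniusNormalizedType (biratData hF hsq) := by
  refine ⟨fun A => ?_⟩
  change (biratOps hF hsq).IsFrobeniusNormalized ((toBirat F hF hsq).obj A)
  intro φ hφ α hα
  -- the hypotheses, read for `C^birat → F_{Φ^gp}` (same base maps and Frobenius degrees)
  have hφ' : IsBaseIdentity (Birat.toElemGp hF hsq) φ := hφ
  have hα' : α ∈ endSubmonoid (Birat.toElemGp hF hsq) ((toBirat F hF hsq).obj A) := ⟨hα.1, hα.2⟩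
  have key := Birat.isFrobeniusNormalized_of_isOfUnitTrivialType hF hsq hiso hut
    ((toBirat F hF hsq).obj A) φ hφ' α hα'
  have hd : (degFr (Birat.toElemGp hF hsq) φ : ℕ) = ((biratOps hF hsq).degFr φ : ℕ) := rfl
  rw [End.mul_def, End.mul_def, ← hd]
  exact key

variable (F) in
/-- **Thm. 5.1 (iv), "Moreover, `C` is of model type"** (FrdI p. 97; Def. 4.5 (i) p. 86: model type =
pre-model type AND birationally Frobenius-normalized type), UNCONDITIONALLY, in the form
`IsOfModelType F hF hsq` consumed by Thm. 5.2 (iv) (`ModelFrobenioidComparison.lean`): a Frobenioid of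
isotropic and unit-trivial type is of model type. The pre-model half ("any skeletal subcategory …
determines a base-section", "any base-section admits an associated Frobenius-section") is seat
abc-iut-L1-d3's `thm51iv_preModel_of_thm51iii`, fed with Thm. 5.1 (iii)'s "In particular" clauses
(`thm51iii_iso_of_baseIso`, `thm51iii_frobeniusTrivial_isAutAmple`), all consumed by name.
[cite: MochizukiFrdI2008, Thm. 5.1 (iv) p.97] -/
theorem isOfModelType_of_isOfUnitTrivialType (hF : IsFrobenioid F) (hsq : HasBiratSquares F)
    (hiso : IsOfIsotropicType F) (hut : IsOfUnitTrivialType F) : IsOfModelType F hF hsq :=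
  ⟨thm51iv_preModel_of_thm51iii F (thm51iii_iso_of_baseIso F) (thm51iii_frobeniusTrivial_isAutAmple F)
      hF hiso hut,
    isBiratFrobeniusNormalized_of_isOfUnitTrivialType F hF hsq hiso hut⟩

variable (F) in
/-- The same with the square-completion hypothesis of the birationalization discharged (Prop. 1.11
(vii), `hasBiratSquares_of_isFrobenioid`): a Frobenioid of isotropic and unit-trivial type is of model
type for THE birationalization `Birat F hF (hasBiratSquares_of_isFrobenioid hF)`.
[cite: MochizukiFrdI2008, Thm. 5.1 (iv) p.97] -/
theorem isOfModelType_of_isOfUnitTrivialType' (hF : IsFrobenioid F) (hiso : IsOfIsotropicType F)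
    (hut : IsOfUnitTrivialType F) : IsOfModelType F hF (hasBiratSquares_of_isFrobenioid hF) :=
  isOfModelType_of_isOfUnitTrivialType F hF (hasBiratSquares_of_isFrobenioid hF) hiso hut

variable (F) in
/-- **Thm. 5.1 (iv)**, the named statement `Thm51iv_modelType` of `DivisorialDescriptionsSections.lean`
(seat abc-iut-L1-t5: `IsFrobenioid F → IsOfIsotropicType F → IsOfUnitTrivialType F →` "pre-model AND
`IsOfBiratFrobeniusNormalizedType B`") DISCHARGED AT THE birationalization `B = biratData hF₀ hsq` (the
datum must be THE birationalization: the statement is a schema in `B`, never to be quantified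
universally). [cite: MochizukiFrdI2008, Thm. 5.1 (iv) p.97] -/
theorem thm51iv_modelType_biratData (hF₀ : IsFrobenioid F) (hsq : HasBiratSquares F) :
    Thm51iv_modelType F (biratData hF₀ hsq) :=
  fun hF hiso hut =>
    ⟨thm51iv_preModel_of_thm51iii F (thm51iii_iso_of_baseIso F) (thm51iii_frobeniusTrivial_isAutAmple F)
        hF hiso hut,
      isOfBiratFrobeniusNormalizedType_biratData_of_isOfUnitTrivialType hF₀ hsq hiso hut⟩

end PreFrobenioid

end Literature.AlgebraicGeometry.Frobenioids
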